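import Literature.Topology.FourManifolds.NonSeparatingSpheres
import Literature.Topology.FourManifolds.CylinderDeckDescent
import Literature.Topology.FourManifolds.Diffeotopy
import Literature.Geometry.Manifold.SubmersionLift
import Literature.Geometry.Manifold.TranslationFlow
import Literature.Geometry.Manifold.SmoothEmbeddingInverse
import HarnessLib

/-!
# Budney–Gabai Thm. 3.13: a sphere which is a fibre of an equivariant fibration function is
# standard

Fact seat of `Literature.Topology.FourManifolds.BudneyGabai2019_thm_3_13`
(`NonSeparatingSpheres.lean`; R. Budney, D. Gabai, *Knotted 3-balls in `S⁴`*, arXiv:1912.09029,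
Thm. 3.13: `Diff(S¹ × Sⁿ)` acts transitively on the non-separating `n`-spheres of `S¹ × Sⁿ`;
*"Moreover, every non-separating `n`-sphere is the fiber of a fiber bundle `S¹ × Sⁿ → S¹`"*).
This file proves the passage **from the fibre-bundle statement to transitivity**, which is how
the classical cases `n ≤ 2` are concluded (cut open along the sphere, recognise `Sⁿ × [0, 1]`,
reglue): in the cyclic cover `ℝ × Sⁿ` (`NonSeparatingSpheresCover.lean`), suppose the lift
`K̃ = ẽ(Sⁿ)` of the sphere `K = e(Sⁿ)` is the zero set of a `C^∞` function `f` without critical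
points which is *equivariant*, `f (t + 2π, y) = f (t, y) + 2π` (so `f` descends to a submersion
`S¹ × Sⁿ → S¹` with fibre `K`).  Then, provided every diffeomorphism of `Sⁿ` homotopic to the
identity is diffeotopic to it (true for `n ≤ 3`; the input for `n = 1, 2` is classical), some
diffeomorphism of `S¹ × Sⁿ` carries the standard sphere `{1} × Sⁿ` onto `K`
(`BudneyGabai2019_thm_3_13.exists_diffeomorph_image_eq_of_fibration`).

## Proof

* §1 `Cylinder.exists_periodic_extension` — **periodic extension from a fundamental domain**: a
  `C^∞` self-map `G` of `ℝ × Y` satisfying the equivariance `G ∘ τ = τ ∘ G` only on a thin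
  strip `{-ε < c < ε}` of a "clock" `c` (`c ∘ τ = c + 2π`) agrees on the fat strip
  `{-ε < c < 2π + ε}` with a globally equivariant `C^∞` map `Ĝ = τᵏ ∘ G ∘ τ⁻ᵏ`, `k = ⌊c/2π⌋`.
* §2 the **flow-out**: lift `∂ₜ` through `f` to a vector field `X` with `df(X) = 1`
  (`Literature.Geometry.Manifold.exists_contMDiff_lift_of_surjective_mfderiv`); `f - t` is
  bounded, so `f` is proper and `X` has a global flow `θ` with `f (θ (s, q)) = f q + s`
  (`Literature.Geometry.Manifold.exists_globalFlow_of_lift`); `H (s, y) = θ (s, ẽ y)` is a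
  diffeomorphism of `ℝ × Sⁿ` with `f ∘ H = pr₁` and `H (0, ·) = ẽ` (its inverse uses the smooth
  inverse of `ẽ` on its range, `Literature.Geometry.Manifold.contMDiffOn_invFun_range`), and
  `H (s + 2π, y) = τ (H (s, φₛ y))` for the **monodromy family** of diffeomorphisms
  `φₛ = ẽ⁻¹ ∘ θ₋ₛ ∘ τ⁻¹ ∘ θ_{s+2π} ∘ ẽ` of `Sⁿ`.
* §3 `φ₀` is **homotopic to the identity** through `y ↦ pr₂ (H⁻¹ (τ₋ᵤ (H (u, y))))`,
  `0 ≤ u ≤ 2π`; by hypothesis it is then diffeotopic to the identity, by a diffeotopy `D`.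
* §4 **untwisting**: with smooth step functions `ℓ`, `m` put
  `Bₛ = φ⁻¹_{m s} ∘ φ₀ ∘ D_{ℓ s}` (`= id` for `s < 1`, `= φ⁻¹_{s-2π}` for `s > 2π - 1`); then
  `G (s, y) = H (s, Bₛ y)` is `τ`-equivariant on the strip `|s| < 1`, so §1 (clock `pr₁`) extends
  it to an equivariant `C^∞` map `Ĝ`, and likewise (clock `f`) for its inverse; `Ĝ` is an
  equivariant diffeomorphism of `ℝ × Sⁿ` with `Ĝ (0, ·) = ẽ`.  It descends
  (`Cylinder.exists_diffeomorph_descend`, `CylinderDeckDescent.lean`) to a diffeomorphism `Φ` of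
  `S¹ × Sⁿ` with `Φ ({1} × Sⁿ) = Φ (π ({0} × Sⁿ)) = π (ẽ (Sⁿ)) = K`.

Everything here is proved; no definition and no named fact is introduced.

## References

* R. Budney, D. Gabai, *Knotted 3-balls in `S⁴`*, arXiv:1912.09029 (v2), §3, Thm. 3.13 (p. 22).
  [BudneyGabai2019]
* Th. Bröcker, K. Jänich, *Introduction to Differential Topology*, CUP (1982), (8.12) (flows of
  lifted fields translate a submersion). [BrockerJanichIDT1982]
* A. Hatcher, *Algebraic Topology*, CUP (2002), §1.3 (deck transformations). [HatcherAT2002]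
-/

noncomputable section

open scoped Manifold ContDiff Topology Real
open Set Function Metric

namespace Literature.Topology.FourManifolds

/-! ### §1 Periodic extension from a fundamental domain -/

namespace Cylinder

section Clock

variable {Y : Type*}

/-- A real function on the cylinder with `c ∘ τ = c + 2π` satisfies `c ∘ τᵐ = c + 2πm`,
`m ∈ ℤ`. [folklore] -/
theorem clock_deck_int {c : ℝ × Y → ℝ} (hcτ : ∀ q : ℝ × Y, c (q.1 + 2 * π, q.2) = c q + 2 * π)
    (m : ℤ) (q : ℝ × Y) : c (q.1 + m * (2 * π), q.2) = c q + m * (2 * π) := by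
  have h := apply_deck_int (F := fun q : ℝ × Y ↦ ((c q, q.2) : ℝ × Y))
    (fun q ↦ by simp [hcτ q]) m q
  simpa using congrArg Prod.fst h

end Clock

section PeriodicExtension

variable {E H : Type*} [NormedAddCommGroup E] [NormedSpace ℝ E] [TopologicalSpace H]
  {I : ModelWithCorners ℝ E H} {Y : Type*} [TopologicalSpace Y] [ChartedSpace H Y]

/-- The translations `(t, y) ↦ (t + a, y)` of the cylinder are `C^∞`. [folklore] -/
theorem contMDiff_translate (a : ℝ) :
    ContMDiff (𝓘(ℝ, ℝ).prod I) (𝓘(ℝ, ℝ).prod I) ∞ fun q : ℝ × Y ↦ ((q.1 + a, q.2) : ℝ × Y) :=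
  ((contDiff_id.add contDiff_const).contMDiff.comp contMDiff_fst).prodMk contMDiff_snd

/-- **Periodic extension from a fundamental domain.**  Let `G : ℝ × Y → ℝ × Y` be `C^∞`, let
`c : ℝ × Y → ℝ` be a continuous "clock" with `c (τ q) = c q + 2π` for the deck transformation
`τ (t, y) = (t + 2π, y)`, and suppose `G (τ q) = τ (G q)` whenever `-ε < c q < ε`
(`0 < ε ≤ 2π`).  Then there is a `C^∞` map `Ĝ` with `Ĝ ∘ τ = τ ∘ Ĝ` everywhere which agrees
with `G` wherever `-ε < c < 2π + ε` — namely `Ĝ = τᵏ ∘ G ∘ τ⁻ᵏ` with `k = ⌊c/2π⌋`, which near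
any point is one fixed smooth conjugate of `G` because neighbouring values of `k` give the same
map on the overlaps, by the hypothesis. [folklore] -/
theorem exists_periodic_extension {G : ℝ × Y → ℝ × Y}
    (hG : ContMDiff (𝓘(ℝ, ℝ).prod I) (𝓘(ℝ, ℝ).prod I) ∞ G)
    {c : ℝ × Y → ℝ} (hc : Continuous c) (hcτ : ∀ q : ℝ × Y, c (q.1 + 2 * π, q.2) = c q + 2 * π)
    {ε : ℝ} (hε : 0 < ε) (hε' : ε ≤ 2 * π)
    (hcompat : ∀ q : ℝ × Y, c q ∈ Ioo (-ε) ε →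
      G (q.1 + 2 * π, q.2) = ((G q).1 + 2 * π, (G q).2)) :
    ∃ Ĝ : ℝ × Y → ℝ × Y, ContMDiff (𝓘(ℝ, ℝ).prod I) (𝓘(ℝ, ℝ).prod I) ∞ Ĝ ∧
      (∀ q : ℝ × Y, Ĝ (q.1 + 2 * π, q.2) = ((Ĝ q).1 + 2 * π, (Ĝ q).2)) ∧
      ∀ q : ℝ × Y, c q ∈ Ioo (-ε) (2 * π + ε) → Ĝ q = G q := by
  have hπ : (0 : ℝ) < 2 * π := by positivity
  -- the candidate: `Ĝ q = τᵏ (G (τ⁻ᵏ q))`, `k = ⌊c q / 2π⌋`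
  set T : ℤ → ℝ × Y → ℝ × Y := fun k q ↦ ((G (q.1 - k * (2 * π), q.2)).1 + k * (2 * π),
    (G (q.1 - k * (2 * π), q.2)).2) with hT
  set Ĝ : ℝ × Y → ℝ × Y := fun q ↦ T ⌊c q / (2 * π)⌋ q with hĜ
  -- neighbouring values of `k` give the same value where the strips overlap
  have hkey : ∀ (q : ℝ × Y) (k : ℤ), c q - k * (2 * π) ∈ Ioo (-ε) (2 * π + ε) →
      Ĝ q = T k q := by
    intro q k hk
    set k₀ : ℤ := ⌊c q / (2 * π)⌋ with hk₀
    have h0 : (k₀ : ℝ) ≤ c q / (2 * π) := Int.floor_le _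
    have h1 : c q / (2 * π) < k₀ + 1 := Int.lt_floor_add_one _
    rw [le_div_iff₀ hπ] at h0
    rw [div_lt_iff₀ hπ] at h1
    show T k₀ q = T k q
    -- `k ∈ {k₀ - 1, k₀, k₀ + 1}`
    have hcases : k = k₀ ∨ k = k₀ + 1 ∨ k = k₀ - 1 := by
      rcases lt_trichotomy k k₀ with hlt | heq | hgt
      · have hle : k ≤ k₀ - 1 := by omega
        rcases hle.lt_or_eq with hlt' | heq'
        · exfalso
          have : (k : ℝ) ≤ k₀ - 2 := by exact_mod_cast (show k ≤ k₀ - 2 by omega)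
          nlinarith [hk.2, hπ]
        · exact Or.inr (Or.inr heq')
      · exact Or.inl heq
      · have hle : k₀ + 1 ≤ k := by omega
        rcases hle.lt_or_eq with hlt' | heq'
        · exfalso
          have : (k₀ : ℝ) + 2 ≤ k := by exact_mod_cast (show k₀ + 2 ≤ k by omega)
          nlinarith [hk.1, hπ]
        · exact Or.inr (Or.inl heq'.symm)
    rcases hcases with rfl | rfl | rfl
    · rfl
    · -- `k = k₀ + 1`: compatibility at `q' = τ^{-(k₀+1)} q`, where `-ε < c q' < 0`
      have hq' := hcompat (q.1 - ((k₀ : ℤ) + 1 : ℤ) * (2 * π), q.2) (by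
        have := clock_deck_int hcτ (-(k₀ + 1)) q
        push_cast at this hk ⊢
        rw [show q.1 - (k₀ + 1) * (2 * π) = q.1 + -(k₀ + 1) * (2 * π) by ring, this]
        constructor <;> nlinarith [hk.1, hk.2, h0])
      simp only at hq'
      simp only [hT]
      have h2 : q.1 - ((k₀ : ℤ) + 1 : ℤ) * (2 * π) + 2 * π = q.1 - k₀ * (2 * π) := by
        push_cast; ring
      rw [h2] at hq'
      rw [hq']
      ext
      · push_cast
        ring
      · simp
    · -- `k = k₀ - 1`: compatibility at `q₀ = τ^{-k₀} q`, where `0 ≤ c q₀ < ε`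
      have hq₀ := hcompat (q.1 - k₀ * (2 * π), q.2) (by
        have := clock_deck_int hcτ (-k₀) q
        push_cast at this hk ⊢
        rw [show q.1 - k₀ * (2 * π) = q.1 + -k₀ * (2 * π) by ring, this]
        constructor <;> nlinarith [hk.1, hk.2, h0])
      simp only at hq₀
      simp only [hT]
      have h2 : q.1 - ((k₀ : ℤ) - 1 : ℤ) * (2 * π) = q.1 - k₀ * (2 * π) + 2 * π := by
        push_cast; ring
      rw [h2, hq₀]
      ext
      · push_cast
        ring
      · simp
  refine ⟨Ĝ, fun q₀ ↦ ?_, fun q ↦ ?_, fun q hq ↦ ?_⟩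
  · -- smoothness at `q₀`: near `q₀`, `Ĝ = T k₀`
    set k₀ : ℤ := ⌊c q₀ / (2 * π)⌋ with hk₀
    have hU : ∀ᶠ q in 𝓝 q₀, c q - k₀ * (2 * π) ∈ Ioo (-ε) (2 * π + ε) := by
      have hcont : Continuous fun q ↦ c q - k₀ * (2 * π) := hc.sub continuous_const
      refine hcont.continuousAt.preimage_mem_nhds (isOpen_Ioo.mem_nhds ?_)
      show c q₀ - k₀ * (2 * π) ∈ Ioo (-ε) (2 * π + ε)
      have h0 : (k₀ : ℝ) ≤ c q₀ / (2 * π) := Int.floor_le _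
      have h1 : c q₀ / (2 * π) < k₀ + 1 := Int.lt_floor_add_one _
      rw [le_div_iff₀ hπ] at h0
      rw [div_lt_iff₀ hπ] at h1
      constructor <;> nlinarith
    have heq : Ĝ =ᶠ[𝓝 q₀] T k₀ := by
      filter_upwards [hU] with q hq
      exact hkey q k₀ hq
    refine ContMDiffAt.congr_of_eventuallyEq ?_ heq
    have h1 : ContMDiff (𝓘(ℝ, ℝ).prod I) (𝓘(ℝ, ℝ).prod I) ∞
        fun q : ℝ × Y ↦ G (q.1 - k₀ * (2 * π), q.2) := by
      have := hG.comp (contMDiff_translate (I := I) (Y := Y) (-(k₀ * (2 * π))))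
      simpa [comp_def, sub_eq_add_neg] using this
    exact ((contMDiff_translate (I := I) (Y := Y) (k₀ * (2 * π))).comp h1).contMDiffAt
  · -- equivariance: `k (τ q) = k q + 1`
    have hk : ⌊c (q.1 + 2 * π, q.2) / (2 * π)⌋ = ⌊c q / (2 * π)⌋ + 1 := by
      rw [hcτ, add_div, div_self hπ.ne', Int.floor_add_one]
    show T ⌊c (q.1 + 2 * π, q.2) / (2 * π)⌋ (q.1 + 2 * π, q.2) = _
    rw [hk]
    show T (⌊c q / (2 * π)⌋ + 1) (q.1 + 2 * π, q.2) =
      (((T ⌊c q / (2 * π)⌋ q).1 + 2 * π), (T ⌊c q / (2 * π)⌋ q).2)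
    simp only [hT]
    have h2 : q.1 + 2 * π - ((⌊c q / (2 * π)⌋ : ℤ) + 1 : ℤ) * (2 * π) =
        q.1 - (⌊c q / (2 * π)⌋ : ℤ) * (2 * π) := by
      push_cast; ring
    rw [h2]
    ext
    · push_cast
      ring
    · simp
  · -- on the fat strip `Ĝ = G`
    have := hkey q 0 (by simpa using hq)
    rw [this]
    simp [hT]

end PeriodicExtension

end Cylinder

/-! ### §2 The flow-out of the lifted sphere along a lift of `∂ₜ` -/

namespace BudneyGabai2019_thm_3_13

variable {n : ℕ}

/-- An equivariant function `f (t + 2π, y) = f (t, y) + 2π` on the cylinder differs from the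
coordinate `t` by a bounded amount. [folklore] -/
theorem exists_abs_sub_fst_le
    {f : ℝ × Metric.sphere (0 : EuclideanSpace ℝ (Fin (n + 1))) 1 → ℝ} (hf : Continuous f)
    (hper : ∀ q, f (q.1 + 2 * π, q.2) = f q + 2 * π) : ∃ C : ℝ, ∀ q, |f q - q.1| ≤ C := by
  have hπ : (0 : ℝ) < 2 * π := by positivity
  set K₀ : Set (ℝ × Metric.sphere (0 : EuclideanSpace ℝ (Fin (n + 1))) 1) :=
    Icc 0 (2 * π) ×ˢ univ with hK₀
  have hK₀c : IsCompact K₀ := isCompact_Icc.prod isCompact_univ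
  obtain ⟨C, hC⟩ := hK₀c.exists_bound_of_continuousOn
    ((hf.sub continuous_fst).continuousOn (s := K₀))
  refine ⟨C, fun q ↦ ?_⟩
  -- reduce `q.1` modulo `2π`
  set m : ℤ := toIcoDiv hπ 0 q.1 with hm
  have hmem : q.1 - m • (2 * π) ∈ Ico (0 : ℝ) (0 + 2 * π) := by
    rw [self_sub_toIcoDiv_zsmul]
    exact toIcoMod_mem_Ico hπ 0 q.1
  have hq₀ : ((q.1 + (-m : ℤ) * (2 * π), q.2) :
      ℝ × Metric.sphere (0 : EuclideanSpace ℝ (Fin (n + 1))) 1) ∈ K₀ := by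
    refine ⟨?_, mem_univ _⟩
    rw [zsmul_eq_mul] at hmem
    simp only [zero_add] at hmem
    push_cast
    constructor <;> nlinarith [hmem.1, hmem.2]
  have hper' := Cylinder.clock_deck_int hper (-m) q
  have h1 := hC _ hq₀
  simp only [Pi.sub_apply, Real.norm_eq_abs, hper'] at h1
  have h2 : f q + (-m : ℤ) * (2 * π) - (q.1 + (-m : ℤ) * (2 * π)) = f q - q.1 := by ring
  rwa [h2] at h1

/-- **The flow-out along a lift of `∂ₜ`.**  Let `f : ℝ × Sⁿ → ℝ` be `C^∞`, equivariant
(`f (t + 2π, y) = f (t, y) + 2π`) and without critical points.  Then a `C^∞` vector field `X`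
with `df(X) = 1` exists (Bröcker–Jänich, proof of (8.12): lifting `∂ₜ` through the submersion
`f`), it is complete because `f` is proper (`|f - t|` is bounded), and its flow `θ` is a `C^∞`
global flow of `ℝ × Sⁿ` translating `f`: `f (θ (s, q)) = f q + s`.
[cite: BrockerJanichIDT1982, (8.12) (proof)] -/
theorem exists_flowOut
    {f : ℝ × Metric.sphere (0 : EuclideanSpace ℝ (Fin (n + 1))) 1 → ℝ}
    (hf : ContMDiff (𝓘(ℝ, ℝ).prod (𝓡 n)) 𝓘(ℝ, ℝ) ∞ f)
    (hper : ∀ q, f (q.1 + 2 * π, q.2) = f q + 2 * π)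
    (hreg : ∀ q, mfderiv (𝓘(ℝ, ℝ).prod (𝓡 n)) 𝓘(ℝ, ℝ) f q ≠ 0) :
    ∃ θ : ℝ × (ℝ × Metric.sphere (0 : EuclideanSpace ℝ (Fin (n + 1))) 1) →
        ℝ × Metric.sphere (0 : EuclideanSpace ℝ (Fin (n + 1))) 1,
      ContMDiff (𝓘(ℝ, ℝ).prod (𝓘(ℝ, ℝ).prod (𝓡 n))) (𝓘(ℝ, ℝ).prod (𝓡 n)) ∞ θ ∧
      (∀ p, θ (0, p) = p) ∧ (∀ t s p, θ (t, θ (s, p)) = θ (t + s, p)) ∧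
      ∀ t p, f (θ (t, p)) = f p + t := by
  -- `df` is onto `ℝ` at every point
  have hsurj : ∀ q, Surjective (mfderiv (𝓘(ℝ, ℝ).prod (𝓡 n)) 𝓘(ℝ, ℝ) f q) := by
    intro q
    set L := mfderiv (𝓘(ℝ, ℝ).prod (𝓡 n)) 𝓘(ℝ, ℝ) f q with hL
    obtain ⟨v, hv⟩ : ∃ v, L v ≠ 0 := by
      by_contra h
      push Not at h
      exact hreg q (ContinuousLinearMap.ext h)
    obtain ⟨x, hx, hx0⟩ : ∃ x : ℝ, x = L v ∧ x ≠ 0 := ⟨L v, rfl, hv⟩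
    change ∀ r : ℝ, ∃ w : TangentSpace (𝓘(ℝ, ℝ).prod (𝓡 n)) q, L w = r
    intro r
    refine ⟨(r / x) • v, ?_⟩
    rw [map_smul, ← hx]
    show r / x * x = r
    exact div_mul_cancel₀ r hx0
  -- `f` is proper
  obtain ⟨C, hC⟩ := exists_abs_sub_fst_le hf.continuous hper
  have hK : ∀ (u : ℝ) (R : ℝ), IsCompact (f ⁻¹' closedBall u R) := by
    intro u R
    refine (isCompact_Icc.prod isCompact_univ :
      IsCompact (Icc (u - R - C) (u + R + C) ×ˢ
        (univ : Set (Metric.sphere (0 : EuclideanSpace ℝ (Fin (n + 1))) 1)))).of_isClosed_subset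
      (isClosed_closedBall.preimage hf.continuous) fun q hq ↦ ⟨?_, mem_univ _⟩
    have h1 : |f q - u| ≤ R := by simpa [Real.dist_eq] using hq
    have h2 := hC q
    rw [abs_le] at h1 h2
    constructor <;> linarith [h1.1, h1.2, h2.1, h2.2]
  obtain ⟨X, hX, hXf⟩ :=
    Literature.Geometry.Manifold.exists_contMDiff_lift_of_surjective_mfderiv hf hsurj (1 : ℝ)
  obtain ⟨θ, hθs, hθ0, hθadd, -, hθf⟩ :=
    Literature.Geometry.Manifold.exists_globalFlow_of_lift hf hX hXf hK
  exact ⟨θ, hθs, hθ0, hθadd, fun t p ↦ by simpa using hθf t p⟩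

/-! ### §3–§4 Untwisting the flow-out and descending -/

/-- **From an equivariant fibration function to an equivariant straightening of the lifted
sphere.**  Let `ẽ : Sⁿ → ℝ × Sⁿ` be a smooth embedding and `f : ℝ × Sⁿ → ℝ` a `C^∞` function
without critical points, equivariant (`f (t + 2π, y) = f (t, y) + 2π`), with `f = 0` exactly on
`ẽ(Sⁿ)`.  Assume that every diffeomorphism of `Sⁿ` homotopic to the identity is diffeotopic to
the identity.  Then there is a diffeomorphism `Ĥ` of `ℝ × Sⁿ` commuting with the deck
transformation `τ (t, y) = (t + 2π, y)` with `Ĥ (0, y) = ẽ y` (so `Ĥ ({0} × Sⁿ) = ẽ(Sⁿ)`,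
`Ĥ ({2πk} × Sⁿ) = τᵏ ẽ(Sⁿ)`).  Construction: flow-out `H (s, y) = θ (s, ẽ y)` of §2, its
monodromy family `φₛ`, the homotopy `φ₀ ≃ id`, the diffeotopy `D` from the hypothesis, the twist
`Bₛ = φ⁻¹_{m s} ∘ φ₀ ∘ D_{ℓ s}` and the periodic extension of `(s, y) ↦ H (s, Bₛ y)` (§1); see
the module docstring. [cite: BudneyGabai2019, Thm. 3.13 ("Moreover" ⇒ transitivity)] -/
theorem exists_equivariant_diffeomorph_of_fibration
    {el : Metric.sphere (0 : EuclideanSpace ℝ (Fin (n + 1))) 1 →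
      ℝ × Metric.sphere (0 : EuclideanSpace ℝ (Fin (n + 1))) 1}
    (hel : Manifold.IsSmoothEmbedding (𝓡 n) (𝓘(ℝ, ℝ).prod (𝓡 n)) ∞ el)
    {f : ℝ × Metric.sphere (0 : EuclideanSpace ℝ (Fin (n + 1))) 1 → ℝ}
    (hf : ContMDiff (𝓘(ℝ, ℝ).prod (𝓡 n)) 𝓘(ℝ, ℝ) ∞ f)
    (hper : ∀ q, f (q.1 + 2 * π, q.2) = f q + 2 * π)
    (hf0 : ∀ q, f q = 0 ↔ q ∈ range el)
    (hreg : ∀ q, mfderiv (𝓘(ℝ, ℝ).prod (𝓡 n)) 𝓘(ℝ, ℝ) f q ≠ 0)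
    (hmono : ∀ φ : Metric.sphere (0 : EuclideanSpace ℝ (Fin (n + 1))) 1 ≃ₘ⟮𝓡 n, 𝓡 n⟯
        Metric.sphere (0 : EuclideanSpace ℝ (Fin (n + 1))) 1,
      (⟨φ, φ.continuous⟩ : C(Metric.sphere (0 : EuclideanSpace ℝ (Fin (n + 1))) 1,
        Metric.sphere (0 : EuclideanSpace ℝ (Fin (n + 1))) 1)).Homotopic (ContinuousMap.id _) →
      Diffeomorph.IsDiffeotopicToId φ) :
    ∃ Ĥ : (ℝ × Metric.sphere (0 : EuclideanSpace ℝ (Fin (n + 1))) 1) ≃ₘ⟮𝓘(ℝ, ℝ).prod (𝓡 n),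
        𝓘(ℝ, ℝ).prod (𝓡 n)⟯ (ℝ × Metric.sphere (0 : EuclideanSpace ℝ (Fin (n + 1))) 1),
      (∀ q, Ĥ (q.1 + 2 * π, q.2) = ((Ĥ q).1 + 2 * π, (Ĥ q).2)) ∧ ∀ y, Ĥ (0, y) = el y := by
  have hπ : (0 : ℝ) < 2 * π := by positivity
  haveI : Nonempty (Metric.sphere (0 : EuclideanSpace ℝ (Fin (n + 1))) 1) :=
    (NormedSpace.sphere_nonempty.2 zero_le_one).to_subtype
  -- ### the flow-out `H (s, y) = θ (s, ẽ y)` (§2)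
  obtain ⟨θ, hθs, hθ0, hθadd, hθf⟩ := exists_flowOut hf hper hreg
  have hinj : Injective el := hel.isEmbedding.injective
  have hli : ∀ y, invFun el (el y) = y := leftInverse_invFun hinj
  have hri : ∀ q, q ∈ range el → el (invFun el q) = q := fun q hq ↦ invFun_eq hq
  have hfel : ∀ y, f (el y) = 0 := fun y ↦ (hf0 _).2 ⟨y, rfl⟩
  have hinvs : ContMDiffOn (𝓘(ℝ, ℝ).prod (𝓡 n)) (𝓡 n) ∞ (invFun el) (range el) :=
    Literature.Geometry.Manifold.contMDiffOn_invFun_range hel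
  have hels : ContMDiff (𝓡 n) (𝓘(ℝ, ℝ).prod (𝓡 n)) ∞ el := hel.contMDiff
  have hθcancel : ∀ t p, θ (-t, θ (t, p)) = p := fun t p ↦ by
    rw [hθadd, neg_add_cancel, hθ0]
  have hθcancel' : ∀ t p, θ (t, θ (-t, p)) = p := fun t p ↦ by
    rw [hθadd, add_neg_cancel, hθ0]
  have hτf : ∀ r : ℝ × Metric.sphere (0 : EuclideanSpace ℝ (Fin (n + 1))) 1,
      f (r.1 - 2 * π, r.2) = f r - 2 * π := fun r ↦ by
    have := hper (r.1 - 2 * π, r.2)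
    simp only [sub_add_cancel, Prod.mk.eta] at this
    linarith
  set H : ℝ × Metric.sphere (0 : EuclideanSpace ℝ (Fin (n + 1))) 1 →
      ℝ × Metric.sphere (0 : EuclideanSpace ℝ (Fin (n + 1))) 1 := fun p ↦ θ (p.1, el p.2) with hH
  set Hinv : ℝ × Metric.sphere (0 : EuclideanSpace ℝ (Fin (n + 1))) 1 →
      ℝ × Metric.sphere (0 : EuclideanSpace ℝ (Fin (n + 1))) 1 :=
    fun q ↦ (f q, invFun el (θ (-f q, q))) with hHinv
  have hfH : ∀ p, f (H p) = p.1 := fun p ↦ by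
    simp only [hH, hθf, hfel, zero_add]
  have hθneg : ∀ q, θ (-f q, q) ∈ range el := fun q ↦ by
    rw [← hf0, hθf]
    ring
  have hHs : ContMDiff (𝓘(ℝ, ℝ).prod (𝓡 n)) (𝓘(ℝ, ℝ).prod (𝓡 n)) ∞ H :=
    hθs.comp (contMDiff_fst.prodMk (hels.comp contMDiff_snd))
  have hHinvs : ContMDiff (𝓘(ℝ, ℝ).prod (𝓡 n)) (𝓘(ℝ, ℝ).prod (𝓡 n)) ∞ Hinv := by
    refine hf.prodMk (hinvs.comp_contMDiff (hθs.comp ?_) hθneg)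
    exact ((contDiff_neg.contMDiff.comp hf).prodMk contMDiff_id)
  have hleft : ∀ p, Hinv (H p) = p := fun p ↦ by
    obtain ⟨s, y⟩ := p
    simp only [hHinv, hfH]
    simp only [hH, hθcancel, hli]
  have hright : ∀ q, H (Hinv q) = q := fun q ↦ by
    simp only [hH, hHinv, hri _ (hθneg q), hθcancel']
  -- ### the monodromy family `φₛ` and its inverse `ψₛ`
  set Φm : ℝ → Metric.sphere (0 : EuclideanSpace ℝ (Fin (n + 1))) 1 →
      Metric.sphere (0 : EuclideanSpace ℝ (Fin (n + 1))) 1 :=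
    fun s y ↦ invFun el (θ (-s, ((θ (s + 2 * π, el y)).1 - 2 * π, (θ (s + 2 * π, el y)).2)))
    with hΦm
  set Ψm : ℝ → Metric.sphere (0 : EuclideanSpace ℝ (Fin (n + 1))) 1 →
      Metric.sphere (0 : EuclideanSpace ℝ (Fin (n + 1))) 1 :=
    fun s y ↦ invFun el (θ (-(s + 2 * π), ((θ (s, el y)).1 + 2 * π, (θ (s, el y)).2)))
    with hΨm
  have hmemΦ : ∀ s y, θ (-s, ((θ (s + 2 * π, el y)).1 - 2 * π, (θ (s + 2 * π, el y)).2)) ∈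
      range el := fun s y ↦ by
    rw [← hf0, hθf, hτf, hθf, hfel]
    ring
  have hmemΨ : ∀ s y, θ (-(s + 2 * π), ((θ (s, el y)).1 + 2 * π, (θ (s, el y)).2)) ∈
      range el := fun s y ↦ by
    rw [← hf0, hθf, hper, hθf, hfel]
    ring
  have helΦ : ∀ s y, el (Φm s y) =
      θ (-s, ((θ (s + 2 * π, el y)).1 - 2 * π, (θ (s + 2 * π, el y)).2)) := fun s y ↦
    hri _ (hmemΦ s y)
  have helΨ : ∀ s y, el (Ψm s y) =
      θ (-(s + 2 * π), ((θ (s, el y)).1 + 2 * π, (θ (s, el y)).2)) := fun s y ↦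
    hri _ (hmemΨ s y)
  -- `H (s + 2π, y) = τ (H (s, φₛ y))`
  have hrel : ∀ s y, H (s + 2 * π, y) = ((H (s, Φm s y)).1 + 2 * π, (H (s, Φm s y)).2) := by
    intro s y
    simp only [hH, helΦ, hθcancel', sub_add_cancel, Prod.mk.eta]
  have hΨΦ : ∀ s y, Ψm s (Φm s y) = y := fun s y ↦ hinj (by
    rw [helΨ, helΦ, hθcancel', sub_add_cancel, Prod.mk.eta, hθadd, neg_add_cancel, hθ0])
  have hΦΨ : ∀ s y, Φm s (Ψm s y) = y := fun s y ↦ hinj (by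
    rw [helΦ, helΨ, hθadd, show s + 2 * π + -(s + 2 * π) = 0 by ring, hθ0]
    simp only [add_sub_cancel_right, Prod.mk.eta, hθcancel])
  have hΦs : ContMDiff (𝓘(ℝ, ℝ).prod (𝓡 n)) (𝓡 n) ∞ (uncurry Φm) := by
    have h1 : ContMDiff (𝓘(ℝ, ℝ).prod (𝓡 n)) (𝓘(ℝ, ℝ).prod (𝓡 n)) ∞
        fun p : ℝ × Metric.sphere (0 : EuclideanSpace ℝ (Fin (n + 1))) 1 ↦
          θ (p.1 + 2 * π, el p.2) :=
      hθs.comp (((contDiff_id.add contDiff_const).contMDiff.comp contMDiff_fst).prodMk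
        (hels.comp contMDiff_snd))
    have h2 : ContMDiff (𝓘(ℝ, ℝ).prod (𝓡 n)) (𝓘(ℝ, ℝ).prod (𝓡 n)) ∞
        fun p : ℝ × Metric.sphere (0 : EuclideanSpace ℝ (Fin (n + 1))) 1 ↦
          θ (-p.1, ((θ (p.1 + 2 * π, el p.2)).1 - 2 * π, (θ (p.1 + 2 * π, el p.2)).2)) :=
      hθs.comp ((contDiff_neg.contMDiff.comp contMDiff_fst).prodMk
        ((Cylinder.contMDiff_translate (I := 𝓡 n) (-(2 * π))).comp h1))
    exact hinvs.comp_contMDiff h2 fun p ↦ hmemΦ p.1 p.2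
  have hΨs : ContMDiff (𝓘(ℝ, ℝ).prod (𝓡 n)) (𝓡 n) ∞ (uncurry Ψm) := by
    have h1 : ContMDiff (𝓘(ℝ, ℝ).prod (𝓡 n)) (𝓘(ℝ, ℝ).prod (𝓡 n)) ∞
        fun p : ℝ × Metric.sphere (0 : EuclideanSpace ℝ (Fin (n + 1))) 1 ↦ θ (p.1, el p.2) :=
      hθs.comp (contMDiff_fst.prodMk (hels.comp contMDiff_snd))
    have h2 : ContMDiff (𝓘(ℝ, ℝ).prod (𝓡 n)) (𝓘(ℝ, ℝ).prod (𝓡 n)) ∞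
        fun p : ℝ × Metric.sphere (0 : EuclideanSpace ℝ (Fin (n + 1))) 1 ↦
          θ (-(p.1 + 2 * π), ((θ (p.1, el p.2)).1 + 2 * π, (θ (p.1, el p.2)).2)) :=
      hθs.comp (((contDiff_id.add contDiff_const).neg.contMDiff.comp contMDiff_fst).prodMk
        ((Cylinder.contMDiff_translate (I := 𝓡 n) (2 * π)).comp h1))
    exact hinvs.comp_contMDiff h2 fun p ↦ hmemΨ p.1 p.2
  -- ### `φ₀` as a diffeomorphism, homotopic to the identity, hence diffeotopic to it
  set φ0 : Metric.sphere (0 : EuclideanSpace ℝ (Fin (n + 1))) 1 ≃ₘ⟮𝓡 n, 𝓡 n⟯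
      Metric.sphere (0 : EuclideanSpace ℝ (Fin (n + 1))) 1 :=
    ⟨⟨Φm 0, Ψm 0, hΨΦ 0, hΦΨ 0⟩, hΦs.comp (contMDiff_const.prodMk contMDiff_id),
      hΨs.comp (contMDiff_const.prodMk contMDiff_id)⟩ with hφ0
  have hφ0c : ∀ y, φ0 y = Φm 0 y := fun y ↦ rfl
  have hhom : (⟨φ0, φ0.continuous⟩ : C(Metric.sphere (0 : EuclideanSpace ℝ (Fin (n + 1))) 1,
      Metric.sphere (0 : EuclideanSpace ℝ (Fin (n + 1))) 1)).Homotopic (ContinuousMap.id _) := by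
    refine ContinuousMap.Homotopic.symm ⟨{
      toFun := fun p ↦ (Hinv (((θ (2 * π * (p.1 : ℝ), el p.2)).1 - 2 * π * (p.1 : ℝ),
        (θ (2 * π * (p.1 : ℝ), el p.2)).2))).2
      continuous_toFun := by
        have helc : Continuous el := hels.continuous
        have hθc : Continuous θ := hθs.continuous
        have hHinvc : Continuous Hinv := hHinvs.continuous
        fun_prop
      map_zero_left := fun y ↦ ?_
      map_one_left := fun y ↦ ?_ }⟩
    · show (Hinv (((θ (2 * π * (0 : ℝ), el y)).1 - 2 * π * (0 : ℝ),
        (θ (2 * π * (0 : ℝ), el y)).2))).2 = y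
      simp only [mul_zero, hθ0, sub_zero, Prod.mk.eta, hHinv, hfel, neg_zero, hli]
    · show (Hinv (((θ (2 * π * (1 : ℝ), el y)).1 - 2 * π * (1 : ℝ),
        (θ (2 * π * (1 : ℝ), el y)).2))).2 = φ0 y
      rw [hφ0c]
      simp only [mul_one, hHinv, hΦm, hτf, hθf, hfel, zero_add, sub_self, neg_zero, hθ0]
  obtain ⟨D, hD⟩ := (hmono φ0 hhom).symm
  have hφ0s : ∀ y, φ0.symm y = Ψm 0 y := fun y ↦ rfl
  have hD1 : ∀ y, D.toFun 1 y = Ψm 0 y := fun y ↦ by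
    have := congrArg (fun ψ : Metric.sphere (0 : EuclideanSpace ℝ (Fin (n + 1))) 1 ≃ₘ⟮𝓡 n, 𝓡 n⟯
      Metric.sphere (0 : EuclideanSpace ℝ (Fin (n + 1))) 1 ↦ ψ y) hD
    simpa [Diffeotopy.coe_stage, hφ0s] using this
  have hDinv1 : ∀ y, D.invFun 1 y = Φm 0 y := fun y ↦ by
    have := D.invFun_toFun 1 (Φm 0 y)
    rwa [hD1, hΨΦ] at this
  -- ### the twist `Bₛ = ψ_{m s} ∘ φ₀ ∘ D_{ℓ s}` and its inverse
  set ℓ : ℝ → ℝ := fun s ↦ Real.smoothTransition ((s - 1) / (π - 1)) with hℓ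
  set m : ℝ → ℝ := fun s ↦ (s - 2 * π) * Real.smoothTransition ((s - π - 1) / (π - 2)) with hm
  have hπ3 : (3 : ℝ) < π := Real.pi_gt_three
  have hℓs : ContDiff ℝ ∞ ℓ :=
    Real.smoothTransition.contDiff.comp ((contDiff_id.sub contDiff_const).div_const _)
  have hms : ContDiff ℝ ∞ m :=
    (contDiff_id.sub contDiff_const).mul (Real.smoothTransition.contDiff.comp
      (((contDiff_id.sub contDiff_const).sub contDiff_const).div_const _))
  have hℓ0 : ∀ s, s < 1 → ℓ s = 0 := fun s hs ↦
    Real.smoothTransition.zero_of_nonpos (div_nonpos_of_nonpos_of_nonneg (by linarith) (by linarith))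
  have hℓ1 : ∀ s, π ≤ s → ℓ s = 1 := fun s hs ↦
    Real.smoothTransition.one_of_one_le ((one_le_div (by linarith)).2 (by linarith))
  have hm0 : ∀ s, s ≤ π + 1 → m s = 0 := fun s hs ↦ by
    simp only [hm]
    rw [Real.smoothTransition.zero_of_nonpos (div_nonpos_of_nonpos_of_nonneg (by linarith)
      (by linarith)), mul_zero]
  have hm1 : ∀ s, 2 * π - 1 < s → m s = s - 2 * π := fun s hs ↦ by
    simp only [hm]
    rw [Real.smoothTransition.one_of_one_le ((one_le_div (by linarith)).2 (by linarith)), mul_one]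
  set B : ℝ → Metric.sphere (0 : EuclideanSpace ℝ (Fin (n + 1))) 1 →
      Metric.sphere (0 : EuclideanSpace ℝ (Fin (n + 1))) 1 :=
    fun s y ↦ Ψm (m s) (Φm 0 (D.toFun (ℓ s) y)) with hB
  set Binv : ℝ → Metric.sphere (0 : EuclideanSpace ℝ (Fin (n + 1))) 1 →
      Metric.sphere (0 : EuclideanSpace ℝ (Fin (n + 1))) 1 :=
    fun s y ↦ D.invFun (ℓ s) (Ψm 0 (Φm (m s) y)) with hBinv
  have hBid : ∀ s, s ∈ Ioo (-1 : ℝ) 1 → ∀ y, B s y = y := fun s hs y ↦ by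
    simp only [hB, hℓ0 s hs.2, hm0 s (by linarith [hs.2]), D.toFun_zero, id, hΨΦ]
  have hBtop : ∀ s, s ∈ Ioo (2 * π - 1) (2 * π + 1) → ∀ y, B s y = Ψm (s - 2 * π) y := by
    intro s hs y
    simp only [hB, hℓ1 s (by linarith [hs.1]), hm1 s hs.1, hD1, hΦΨ]
  have hBinvid : ∀ s, s ∈ Ioo (-1 : ℝ) 1 → ∀ y, Binv s y = y := fun s hs y ↦ by
    simp only [hBinv, hℓ0 s hs.2, hm0 s (by linarith [hs.2]), D.invFun_zero, id, hΨΦ]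
  have hBinvtop : ∀ s, s ∈ Ioo (2 * π - 1) (2 * π + 1) → ∀ y,
      Binv s y = Φm (s - 2 * π) y := by
    intro s hs y
    simp only [hBinv, hℓ1 s (by linarith [hs.1]), hm1 s hs.1, hDinv1, hΦΨ]
  have hBB : ∀ s y, Binv s (B s y) = y := fun s y ↦ by
    simp only [hB, hBinv, hΦΨ, hΨΦ, D.invFun_toFun]
  have hBB' : ∀ s y, B s (Binv s y) = y := fun s y ↦ by
    simp only [hB, hBinv, D.toFun_invFun, hΦΨ, hΨΦ]
  have hBs : ContMDiff (𝓘(ℝ, ℝ).prod (𝓡 n)) (𝓡 n) ∞ (uncurry B) := by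
    have h1 : ContMDiff (𝓘(ℝ, ℝ).prod (𝓡 n)) (𝓡 n) ∞
        fun p : ℝ × Metric.sphere (0 : EuclideanSpace ℝ (Fin (n + 1))) 1 ↦
          D.toFun (ℓ p.1) p.2 :=
      D.contMDiff_uncurry_toFun.comp ((hℓs.contMDiff.comp contMDiff_fst).prodMk contMDiff_snd)
    have h2 : ContMDiff (𝓘(ℝ, ℝ).prod (𝓡 n)) (𝓡 n) ∞
        fun p : ℝ × Metric.sphere (0 : EuclideanSpace ℝ (Fin (n + 1))) 1 ↦
          Φm 0 (D.toFun (ℓ p.1) p.2) :=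
      hΦs.comp (contMDiff_const.prodMk h1)
    exact hΨs.comp ((hms.contMDiff.comp contMDiff_fst).prodMk h2)
  have hBinvs : ContMDiff (𝓘(ℝ, ℝ).prod (𝓡 n)) (𝓡 n) ∞ (uncurry Binv) := by
    have h1 : ContMDiff (𝓘(ℝ, ℝ).prod (𝓡 n)) (𝓡 n) ∞
        fun p : ℝ × Metric.sphere (0 : EuclideanSpace ℝ (Fin (n + 1))) 1 ↦ Φm (m p.1) p.2 :=
      hΦs.comp ((hms.contMDiff.comp contMDiff_fst).prodMk contMDiff_snd)
    have h2 : ContMDiff (𝓘(ℝ, ℝ).prod (𝓡 n)) (𝓡 n) ∞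
        fun p : ℝ × Metric.sphere (0 : EuclideanSpace ℝ (Fin (n + 1))) 1 ↦
          Ψm 0 (Φm (m p.1) p.2) :=
      hΨs.comp (contMDiff_const.prodMk h1)
    exact D.contMDiff_uncurry_invFun.comp ((hℓs.contMDiff.comp contMDiff_fst).prodMk h2)
  -- ### the strip maps `G (s, y) = H (s, Bₛ y)`, `G' = (id × B⁻¹) ∘ H⁻¹`, and their extensions
  set G : ℝ × Metric.sphere (0 : EuclideanSpace ℝ (Fin (n + 1))) 1 →
      ℝ × Metric.sphere (0 : EuclideanSpace ℝ (Fin (n + 1))) 1 :=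
    fun q ↦ H (q.1, B q.1 q.2) with hG
  set G' : ℝ × Metric.sphere (0 : EuclideanSpace ℝ (Fin (n + 1))) 1 →
      ℝ × Metric.sphere (0 : EuclideanSpace ℝ (Fin (n + 1))) 1 :=
    fun q ↦ ((Hinv q).1, Binv (Hinv q).1 (Hinv q).2) with hG'
  have hGs : ContMDiff (𝓘(ℝ, ℝ).prod (𝓡 n)) (𝓘(ℝ, ℝ).prod (𝓡 n)) ∞ G :=
    hHs.comp (contMDiff_fst.prodMk hBs)
  have hG's : ContMDiff (𝓘(ℝ, ℝ).prod (𝓡 n)) (𝓘(ℝ, ℝ).prod (𝓡 n)) ∞ G' :=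
    (contMDiff_fst.comp hHinvs).prodMk (hBinvs.comp hHinvs)
  have hGcompat : ∀ q : ℝ × Metric.sphere (0 : EuclideanSpace ℝ (Fin (n + 1))) 1,
      q.1 ∈ Ioo (-1 : ℝ) 1 → G (q.1 + 2 * π, q.2) = ((G q).1 + 2 * π, (G q).2) := by
    intro q hq
    have h1 : q.1 + 2 * π ∈ Ioo (2 * π - 1) (2 * π + 1) := ⟨by linarith [hq.1], by linarith [hq.2]⟩
    simp only [hG, hBtop _ h1, add_sub_cancel_right, hBid _ hq]
    rw [hrel q.1 (Ψm q.1 q.2), hΦΨ]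
  have hG'compat : ∀ q : ℝ × Metric.sphere (0 : EuclideanSpace ℝ (Fin (n + 1))) 1,
      f q ∈ Ioo (-1 : ℝ) 1 → G' (q.1 + 2 * π, q.2) = ((G' q).1 + 2 * π, (G' q).2) := by
    intro q hq
    -- write `q = H (s, z)`
    set s := (Hinv q).1 with hs
    set z := (Hinv q).2 with hz
    have hsf : s = f q := rfl
    have hqH : q = H (s, z) := (hright q).symm
    have h1 : s + 2 * π ∈ Ioo (2 * π - 1) (2 * π + 1) := ⟨by linarith [hq.1], by linarith [hq.2]⟩
    -- `τ q = H (s + 2π, ψₛ z)`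
    have hτq : ((q.1 + 2 * π, q.2) : ℝ × Metric.sphere (0 : EuclideanSpace ℝ (Fin (n + 1))) 1) =
        H (s + 2 * π, Ψm s z) := by
      rw [hrel, hΦΨ, ← hqH]
    have h2 : Hinv (q.1 + 2 * π, q.2) = (s + 2 * π, Ψm s z) := by rw [hτq, hleft]
    simp only [hG']
    rw [h2]
    simp only [hBinvtop _ h1, add_sub_cancel_right, hΦΨ]
    rw [← hs, ← hz, hBinvid _ (hsf ▸ hq)]
  obtain ⟨Ĝ, hĜs, hĜeq, hĜG⟩ := Cylinder.exists_periodic_extension hGs continuous_fst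
    (fun q ↦ rfl) one_pos (by linarith) hGcompat
  obtain ⟨Ĝ', hĜ's, hĜ'eq, hĜ'G'⟩ := Cylinder.exists_periodic_extension hG's hf.continuous
    hper one_pos (by linarith) hG'compat
  -- ### `Ĝ` and `Ĝ'` are mutually inverse
  have hfG : ∀ q, f (G q) = q.1 := fun q ↦ hfH _
  have hG'G : ∀ q, G' (G q) = q := fun q ↦ by
    simp only [hG', hG, hleft, hBB]
  have hGG' : ∀ q, G (G' q) = q := fun q ↦ by
    simp only [hG, hG', hBB']
    exact hright q
  have hfat : ∀ x : ℝ, x ∈ Ico (0 : ℝ) (2 * π) → x ∈ Ioo (-1 : ℝ) (2 * π + 1) := fun x hx ↦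
    ⟨by linarith [hx.1], by linarith [hx.2]⟩
  have hinv1 : ∀ q, Ĝ' (Ĝ q) = q := by
    intro q
    -- reduce to the fundamental strip
    set k : ℤ := ⌊q.1 / (2 * π)⌋ with hk
    have h0 : (k : ℝ) ≤ q.1 / (2 * π) := Int.floor_le _
    have h1 : q.1 / (2 * π) < k + 1 := Int.lt_floor_add_one _
    rw [le_div_iff₀ hπ] at h0
    rw [div_lt_iff₀ hπ] at h1
    set q₀ : ℝ × Metric.sphere (0 : EuclideanSpace ℝ (Fin (n + 1))) 1 :=
      (q.1 - k * (2 * π), q.2) with hq₀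
    have hq₀m : q₀.1 ∈ Ico (0 : ℝ) (2 * π) := ⟨by simp [hq₀]; linarith, by simp [hq₀]; linarith⟩
    have hq : q = (q₀.1 + k * (2 * π), q₀.2) := by simp [hq₀]
    rw [hq, Cylinder.apply_deck_int hĜeq k q₀, hĜG q₀ (hfat _ hq₀m),
      Cylinder.apply_deck_int hĜ'eq k (G q₀), hĜ'G' _ (by rw [hfG]; exact hfat _ hq₀m), hG'G]
  have hinv2 : ∀ q, Ĝ (Ĝ' q) = q := by
    intro q
    set k : ℤ := ⌊f q / (2 * π)⌋ with hk
    have h0 : (k : ℝ) ≤ f q / (2 * π) := Int.floor_le _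
    have h1 : f q / (2 * π) < k + 1 := Int.lt_floor_add_one _
    rw [le_div_iff₀ hπ] at h0
    rw [div_lt_iff₀ hπ] at h1
    set q₀ : ℝ × Metric.sphere (0 : EuclideanSpace ℝ (Fin (n + 1))) 1 :=
      (q.1 + (-k : ℤ) * (2 * π), q.2) with hq₀
    have hfq₀ : f q₀ = f q - k * (2 * π) := by
      rw [hq₀, Cylinder.clock_deck_int hper (-k) q]
      push_cast
      ring
    have hq₀m : f q₀ ∈ Ico (0 : ℝ) (2 * π) := ⟨by rw [hfq₀]; linarith, by rw [hfq₀]; linarith⟩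
    have hq : q = (q₀.1 + k * (2 * π), q₀.2) := by
      simp only [hq₀]
      push_cast
      ext <;> simp
    have hG'q₀ : (G' q₀).1 = f q₀ := rfl
    rw [hq, Cylinder.apply_deck_int hĜ'eq k q₀, hĜ'G' q₀ (hfat _ hq₀m),
      Cylinder.apply_deck_int hĜeq k (G' q₀), hĜG _ (by rw [hG'q₀]; exact hfat _ hq₀m), hGG']
  -- ### the equivariant diffeomorphism
  refine ⟨⟨⟨Ĝ, Ĝ', hinv1, hinv2⟩, hĜs, hĜ's⟩, hĜeq, fun y ↦ ?_⟩
  show Ĝ (0, y) = el y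
  rw [hĜG (0, y) ⟨by norm_num, by positivity⟩]
  simp only [hG, hBid 0 ⟨by norm_num, by norm_num⟩, hH, hθ0]

/-- **Budney–Gabai Thm. 3.13 from the fibre-bundle statement.**  Let `e : Sⁿ → S¹ × Sⁿ` be a
map with a smoothly embedded lift `ẽ` to the cyclic cover (`(exp × id) ∘ ẽ = e`), and suppose
`ẽ(Sⁿ)` is the zero set of an equivariant `C^∞` function `f : ℝ × Sⁿ → ℝ`
(`f (t + 2π, y) = f (t, y) + 2π`) without critical points — i.e. `e(Sⁿ)` is a fibre of the
submersion `S¹ × Sⁿ → S¹` induced by `f`.  If every diffeomorphism of `Sⁿ` homotopic to the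
identity is diffeotopic to it, then some diffeomorphism of `S¹ × Sⁿ` carries the standard sphere
`{1} × Sⁿ` onto `e(Sⁿ)`: descend the equivariant diffeomorphism of
`exists_equivariant_diffeomorph_of_fibration` (`Cylinder.exists_diffeomorph_descend`).
[cite: BudneyGabai2019, Thm. 3.13] -/
theorem exists_diffeomorph_image_eq_of_fibration
    {e : Metric.sphere (0 : EuclideanSpace ℝ (Fin (n + 1))) 1 →
      Circle × Metric.sphere (0 : EuclideanSpace ℝ (Fin (n + 1))) 1}
    {el : Metric.sphere (0 : EuclideanSpace ℝ (Fin (n + 1))) 1 →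
      ℝ × Metric.sphere (0 : EuclideanSpace ℝ (Fin (n + 1))) 1}
    (hel : Manifold.IsSmoothEmbedding (𝓡 n) (𝓘(ℝ, ℝ).prod (𝓡 n)) ∞ el)
    (hlift : Prod.map Circle.exp id ∘ el = e)
    {f : ℝ × Metric.sphere (0 : EuclideanSpace ℝ (Fin (n + 1))) 1 → ℝ}
    (hf : ContMDiff (𝓘(ℝ, ℝ).prod (𝓡 n)) 𝓘(ℝ, ℝ) ∞ f)
    (hper : ∀ q, f (q.1 + 2 * π, q.2) = f q + 2 * π)
    (hf0 : ∀ q, f q = 0 ↔ q ∈ range el)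
    (hreg : ∀ q, mfderiv (𝓘(ℝ, ℝ).prod (𝓡 n)) 𝓘(ℝ, ℝ) f q ≠ 0)
    (hmono : ∀ φ : Metric.sphere (0 : EuclideanSpace ℝ (Fin (n + 1))) 1 ≃ₘ⟮𝓡 n, 𝓡 n⟯
        Metric.sphere (0 : EuclideanSpace ℝ (Fin (n + 1))) 1,
      (⟨φ, φ.continuous⟩ : C(Metric.sphere (0 : EuclideanSpace ℝ (Fin (n + 1))) 1,
        Metric.sphere (0 : EuclideanSpace ℝ (Fin (n + 1))) 1)).Homotopic (ContinuousMap.id _) →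
      Diffeomorph.IsDiffeotopicToId φ) :
    ∃ Φ : (Circle × Metric.sphere (0 : EuclideanSpace ℝ (Fin (n + 1))) 1) ≃ₘ⟮(𝓡 1).prod (𝓡 n),
        (𝓡 1).prod (𝓡 n)⟯ (Circle × Metric.sphere (0 : EuclideanSpace ℝ (Fin (n + 1))) 1),
      Φ '' range (standardSphere n) = range e := by
  obtain ⟨Ĥ, hĤeq, hĤ0⟩ := exists_equivariant_diffeomorph_of_fibration hel hf hper hf0 hreg hmono
  obtain ⟨Φ, hΦ⟩ := Cylinder.exists_diffeomorph_descend Ĥ hĤeq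
  refine ⟨Φ, ?_⟩
  have h1 : range (standardSphere n) = Prod.map Circle.exp id ''
      range (fun p : Metric.sphere (0 : EuclideanSpace ℝ (Fin (n + 1))) 1 ↦ ((0 : ℝ), p)) := by
    rw [← range_comp]
    exact congrArg range (funext fun p ↦ by simp)
  rw [h1, Cylinder.image_descend hΦ, ← range_comp, ← range_comp, ← hlift]
  exact congrArg range (funext fun p ↦ by simp [hĤ0])


end BudneyGabai2019_thm_3_13

end Literature.Topology.FourManifolds

end
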